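import Literature.Probability.Percolation.UniversalTightness
import Mathlib.Analysis.Complex.ExponentialBounds
import HarnessLib

/-!
# Truncating the cluster size at the typical maximum (Hutchcroft 2022, Lemma 2.9)

Topic `Literature/Probability/Percolation`. Theorem-only sequel of `UniversalTightness.lean`,
toward the named fact `Hutchcroft2022_twoPoint_volumeTail`. For a product Bernoulli measure on
the bonds of `V`, a nonempty finite `Λ ⊆ V`, a vertex `u` and `M = M(Λ)` the typical value of
`|K_max(Λ)|`:

* layer-cake formulas for `|K_u ∩ Λ|` and its truncation `|K_u ∩ Λ| ∧ τ`
  (`clusterCapIn_real_eq_sum_indicator`, `min_clusterCapIn_eq_sum_indicator`,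
  `integral_clusterCapIn_eq_sum_real_ge`, `integral_min_clusterCapIn_eq_sum`);
* `sum_real_clusterCapIn_ge_tail_le` — `Σ_{n ≥ 10M} P(|K_u ∩ Λ| > n) ≤ ¼ Σ_n P(|K_u ∩ Λ| > n)`
  (rooted universal tightness (2.6) and Markov's inequality);
* **`integral_min_clusterCapIn_ge`** — Lemma 2.9 with explicit constants:
  `E[|K_u ∩ Λ| ∧ τ] ≥ ½ min(1, τ/(10M)) E|K_u ∩ Λ|` for every `τ > 0` (the printed
  `E[|K| ∧ λM] ≥ aλ E|K|`, `0 < λ ≤ 1`, with `τ = λM`).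

Constants differ from the printed ones (our (2.6) is `P(|K_u∩Λ| ≥ aM) ≤ e^{(3-a)/2} P(≥ M)`).

## References

* [Hutchcroft2022] T. Hutchcroft, J. Math. Phys. 63 (2022), arXiv:2202.07634, Lemma 2.9 and its
  proof (pp. 10–11).
* [Hutchcroft2021] T. Hutchcroft, arXiv:2008.11197, Thm. 2.2 (universal tightness).
-/

noncomputable section

namespace Literature.Probability.Percolation

open Finset MeasureTheory Literature.Probability.LatticeModels

variable {V : Type*}

/-! ### Layer-cake formulas for `|K_u ∩ Λ|` -/

section LayerCake

/-- `|K_u ∩ Λ| = Σ_{n < |Λ|} 𝟙{|K_u ∩ Λ| > n}`. [folklore] -/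
theorem clusterCapIn_real_eq_sum_indicator (Λ : Finset V) (ω : BondConfig V) (u : V) :
    (clusterCapIn Λ ω u : ℝ) = ∑ n ∈ Finset.range Λ.card,
      ({ω : BondConfig V | n + 1 ≤ clusterCapIn Λ ω u}).indicator (fun _ => (1 : ℝ)) ω := by
  have hk := clusterCapIn_le_card Λ ω u
  set k := clusterCapIn Λ ω u with hkdef
  have : ∀ n ∈ Finset.range Λ.card, ({ω : BondConfig V | n + 1 ≤ clusterCapIn Λ ω u}).indicator
      (fun _ => (1 : ℝ)) ω = if n < k then 1 else 0 := by
    intro n _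
    by_cases h : n < k
    · rw [if_pos h, Set.indicator_of_mem (show ω ∈ {ω | n + 1 ≤ clusterCapIn Λ ω u} from h)]
    · rw [if_neg h, Set.indicator_of_notMem (show ω ∉ {ω | n + 1 ≤ clusterCapIn Λ ω u} from h)]
  rw [Finset.sum_congr rfl this, Finset.sum_boole]
  have hf : (Finset.range Λ.card).filter (fun n => n < k) = Finset.range k := by
    ext n; simp only [Finset.mem_filter, Finset.mem_range]; omega
  rw [hf, Finset.card_range]

/-- **Truncation, layer by layer**: `|K_u ∩ Λ| ∧ τ = Σ_{n < |Λ|} ((n+1) ∧ τ - n ∧ τ) 𝟙{|K_u ∩ Λ| > n}`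
(`τ ≥ 0`). [folklore] -/
theorem min_clusterCapIn_eq_sum_indicator (Λ : Finset V) (ω : BondConfig V) (u : V) {τ : ℝ}
    (hτ : 0 ≤ τ) :
    min (clusterCapIn Λ ω u : ℝ) τ = ∑ n ∈ Finset.range Λ.card,
      (min ((n : ℝ) + 1) τ - min (n : ℝ) τ) *
        ({ω : BondConfig V | n + 1 ≤ clusterCapIn Λ ω u}).indicator (fun _ => (1 : ℝ)) ω := by
  have hk := clusterCapIn_le_card Λ ω u
  set k := clusterCapIn Λ ω u with hkdef
  have : ∀ n ∈ Finset.range Λ.card, (min ((n : ℝ) + 1) τ - min (n : ℝ) τ) *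
      ({ω : BondConfig V | n + 1 ≤ clusterCapIn Λ ω u}).indicator (fun _ => (1 : ℝ)) ω =
        if n < k then min ((n : ℝ) + 1) τ - min (n : ℝ) τ else 0 := by
    intro n _
    by_cases h : n < k
    · rw [if_pos h, Set.indicator_of_mem (show ω ∈ {ω | n + 1 ≤ clusterCapIn Λ ω u} from h),
        mul_one]
    · rw [if_neg h, Set.indicator_of_notMem (show ω ∉ {ω | n + 1 ≤ clusterCapIn Λ ω u} from h),
        mul_zero]
  rw [Finset.sum_congr rfl this, ← Finset.sum_filter]
  have hf : (Finset.range Λ.card).filter (fun n => n < k) = Finset.range k := by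
    ext n; simp only [Finset.mem_filter, Finset.mem_range]; omega
  rw [hf]
  simp_rw [← Nat.cast_succ]
  rw [Finset.sum_range_sub (fun n => min (n : ℝ) τ) k]
  simp [min_eq_left hτ]

variable [DecidableEq V] [Countable V]

/-- `ω ↦ |K_u ∩ Λ| ∧ τ` is integrable (finite measure). [folklore] -/
theorem integrable_min_clusterCapIn (μ : Measure (BondConfig V)) [IsFiniteMeasure μ]
    (Λ : Finset V) (u : V) {τ : ℝ} (hτ : 0 ≤ τ) :
    Integrable (fun ω => min (clusterCapIn Λ ω u : ℝ) τ) μ := by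
  have h : (fun ω => min (clusterCapIn Λ ω u : ℝ) τ) = fun ω => ∑ n ∈ Finset.range Λ.card,
      (min ((n : ℝ) + 1) τ - min (n : ℝ) τ) *
        ({ω : BondConfig V | n + 1 ≤ clusterCapIn Λ ω u}).indicator (fun _ => (1 : ℝ)) ω :=
    funext fun ω => min_clusterCapIn_eq_sum_indicator Λ ω u hτ
  rw [h]
  exact integrable_finsetSum _ fun n _ =>
    ((integrable_const (1 : ℝ)).indicator (measurableSet_clusterCapIn_ge Λ u (n + 1))).const_mul _

/-- `ω ↦ |K_u ∩ Λ|` is integrable (finite measure). [folklore] -/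
theorem integrable_clusterCapIn_real (μ : Measure (BondConfig V)) [IsFiniteMeasure μ]
    (Λ : Finset V) (u : V) : Integrable (fun ω => (clusterCapIn Λ ω u : ℝ)) μ := by
  have h : (fun ω => (clusterCapIn Λ ω u : ℝ)) = fun ω => ∑ n ∈ Finset.range Λ.card,
      ({ω : BondConfig V | n + 1 ≤ clusterCapIn Λ ω u}).indicator (fun _ => (1 : ℝ)) ω :=
    funext fun ω => clusterCapIn_real_eq_sum_indicator Λ ω u
  rw [h]
  exact integrable_finsetSum _ fun n _ =>
    (integrable_const (1 : ℝ)).indicator (measurableSet_clusterCapIn_ge Λ u (n + 1))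

/-- **`E|K_u ∩ Λ| = Σ_{n < |Λ|} P(|K_u ∩ Λ| > n)`.** [cite: Hutchcroft2022, proof of Lemma 2.9 (p. 11)] -/
theorem integral_clusterCapIn_eq_sum_real_ge (μ : Measure (BondConfig V)) [IsFiniteMeasure μ]
    (Λ : Finset V) (u : V) :
    ∫ ω, (clusterCapIn Λ ω u : ℝ) ∂μ =
      ∑ n ∈ Finset.range Λ.card, μ.real {ω | n + 1 ≤ clusterCapIn Λ ω u} := by
  have h : (fun ω => (clusterCapIn Λ ω u : ℝ)) = fun ω => ∑ n ∈ Finset.range Λ.card,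
      ({ω : BondConfig V | n + 1 ≤ clusterCapIn Λ ω u}).indicator (fun _ => (1 : ℝ)) ω :=
    funext fun ω => clusterCapIn_real_eq_sum_indicator Λ ω u
  rw [h, integral_finsetSum _ fun n _ =>
    (integrable_const (1 : ℝ)).indicator (measurableSet_clusterCapIn_ge Λ u (n + 1))]
  refine Finset.sum_congr rfl fun n _ => ?_
  rw [integral_indicator_const _ (measurableSet_clusterCapIn_ge Λ u (n + 1)), smul_eq_mul, mul_one]

/-- **`E[|K_u ∩ Λ| ∧ τ] = Σ_{n < |Λ|} ((n+1) ∧ τ - n ∧ τ) P(|K_u ∩ Λ| > n)`** (`τ ≥ 0`).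
[cite: Hutchcroft2022, proof of Lemma 2.9 (p. 11)] -/
theorem integral_min_clusterCapIn_eq_sum (μ : Measure (BondConfig V)) [IsFiniteMeasure μ]
    (Λ : Finset V) (u : V) {τ : ℝ} (hτ : 0 ≤ τ) :
    ∫ ω, min (clusterCapIn Λ ω u : ℝ) τ ∂μ = ∑ n ∈ Finset.range Λ.card,
      (min ((n : ℝ) + 1) τ - min (n : ℝ) τ) * μ.real {ω | n + 1 ≤ clusterCapIn Λ ω u} := by
  have h : (fun ω => min (clusterCapIn Λ ω u : ℝ) τ) = fun ω => ∑ n ∈ Finset.range Λ.card,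
      (min ((n : ℝ) + 1) τ - min (n : ℝ) τ) *
        ({ω : BondConfig V | n + 1 ≤ clusterCapIn Λ ω u}).indicator (fun _ => (1 : ℝ)) ω :=
    funext fun ω => min_clusterCapIn_eq_sum_indicator Λ ω u hτ
  rw [h, integral_finsetSum _ fun n _ =>
    ((integrable_const (1 : ℝ)).indicator (measurableSet_clusterCapIn_ge Λ u (n + 1))).const_mul _]
  refine Finset.sum_congr rfl fun n _ => ?_
  rw [integral_const_mul, integral_indicator_const _ (measurableSet_clusterCapIn_ge Λ u (n + 1)),
    smul_eq_mul, mul_one]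

/-- The layer coefficients are nonnegative. [folklore] -/
theorem min_succ_sub_min_nonneg (n : ℕ) (τ : ℝ) : 0 ≤ min ((n : ℝ) + 1) τ - min (n : ℝ) τ :=
  sub_nonneg.2 (min_le_min_right τ (by linarith))

/-- The layer coefficients are at most `1`. [folklore] -/
theorem min_succ_sub_min_le_one (n : ℕ) (τ : ℝ) : min ((n : ℝ) + 1) τ - min (n : ℝ) τ ≤ 1 := by
  rcases le_total ((n : ℝ) + 1) τ with h | h
  · rw [min_eq_left h, min_eq_left (by linarith)]; linarith
  · rw [min_eq_right h]
    have := min_le_right (n : ℝ) τ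
    rcases le_total (n : ℝ) τ with h' | h'
    · rw [min_eq_left h']; linarith
    · rw [min_eq_right h']; linarith

end LayerCake

/-! ### Lemma 2.9 -/

section Truncation

variable [DecidableEq V] [Countable V] (p : Sym2 V → unitInterval) {Λ : Finset V}

omit [DecidableEq V] [Countable V] in
/-- **`M · P(|K_u ∩ Λ| ≥ M) ≤ E|K_u ∩ Λ|`** (Markov, in layer-cake form). [cite: Hutchcroft2022, proof of Lemma 2.9 ("It follows by Markov's inequality …")] -/
theorem typicalMax_mul_real_le_sum (u : V) :
    (typicalMax (prodBernoulli p) Λ : ℝ) *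
        (prodBernoulli p).real {ω | typicalMax (prodBernoulli p) Λ ≤ clusterCapIn Λ ω u} ≤
      ∑ n ∈ Finset.range Λ.card, (prodBernoulli p).real {ω | n + 1 ≤ clusterCapIn Λ ω u} := by
  set μ := prodBernoulli p with hμ
  set M := typicalMax μ Λ with hM
  rcases le_or_gt M Λ.card with hMc | hMc
  · calc (M : ℝ) * μ.real {ω | M ≤ clusterCapIn Λ ω u}
        = ∑ _n ∈ Finset.range M, μ.real {ω | M ≤ clusterCapIn Λ ω u} := by
          rw [Finset.sum_const, Finset.card_range, nsmul_eq_mul]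
      _ ≤ ∑ n ∈ Finset.range M, μ.real {ω | n + 1 ≤ clusterCapIn Λ ω u} := by
          refine Finset.sum_le_sum fun n hn => measureReal_mono (fun ω hω => ?_) (measure_ne_top _ _)
          simp only [Set.mem_setOf_eq, Finset.mem_range] at hω hn ⊢
          omega
      _ ≤ ∑ n ∈ Finset.range Λ.card, μ.real {ω | n + 1 ≤ clusterCapIn Λ ω u} :=
          Finset.sum_le_sum_of_subset_of_nonneg (Finset.range_subset_range.2 hMc)
            fun _ _ _ => measureReal_nonneg
  · -- `M > |Λ|`: the event is empty
    have h0 : μ.real {ω | M ≤ clusterCapIn Λ ω u} = 0 := by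
      have : {ω : BondConfig V | M ≤ clusterCapIn Λ ω u} = ∅ :=
        Set.eq_empty_of_forall_notMem fun ω hω =>
          absurd (le_trans hω (clusterCapIn_le_card Λ ω u)) (not_le.2 hMc)
      rw [this, measureReal_empty]
    rw [h0, mul_zero]
    exact Finset.sum_nonneg fun _ _ => measureReal_nonneg

/-- `4 e^{-7/2} ≤ 1/4` (`e³ ≥ 19`). [folklore] -/
theorem four_mul_exp_neg_le : 4 * Real.exp (-(7 / 2 : ℝ)) ≤ 1 / 4 := by
  have h1 : (2.7 : ℝ) < Real.exp 1 := lt_trans (by norm_num) Real.exp_one_gt_d9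
  have h3 : (19 : ℝ) ≤ Real.exp 3 := by
    have : Real.exp 3 = Real.exp 1 ^ 3 := by rw [← Real.exp_nat_mul]; norm_num
    rw [this]
    nlinarith [pow_le_pow_left₀ (by norm_num : (0 : ℝ) ≤ 2.7) h1.le 3]
  have h4 : Real.exp 3 ≤ Real.exp (7 / 2) := Real.exp_le_exp.2 (by norm_num)
  rw [Real.exp_neg]
  have hpos : 0 < Real.exp (7 / 2) := Real.exp_pos _
  rw [mul_inv_le_iff₀ hpos]
  linarith

/-- **The tail beyond `10 M` is at most a quarter of `E|K_u ∩ Λ|`**: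
`Σ_{10M ≤ n < |Λ|} P(|K_u ∩ Λ| > n) ≤ ¼ Σ_{n < |Λ|} P(|K_u ∩ Λ| > n)` (rooted universal tightness
(2.6): each term is `≤ e^{(3-n/M)/2} P(|K_u∩Λ| ≥ M)`, a geometric series, and `M P(≥ M) ≤ E|K|`).
[cite: Hutchcroft2022, proof of Lemma 2.9 (p. 11)] -/
theorem sum_real_clusterCapIn_ge_tail_le (hΛ : Λ.Nonempty) (u : V) :
    ∑ n ∈ Finset.Ico (10 * typicalMax (prodBernoulli p) Λ) Λ.card,
        (prodBernoulli p).real {ω | n + 1 ≤ clusterCapIn Λ ω u} ≤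
      (1 / 4) * ∑ n ∈ Finset.range Λ.card, (prodBernoulli p).real {ω | n + 1 ≤ clusterCapIn Λ ω u} := by
  set μ := prodBernoulli p with hμ
  set M := typicalMax μ Λ with hM
  have hM2 : 2 ≤ M := two_le_typicalMax μ hΛ
  have hMpos : (0 : ℝ) < M := by exact_mod_cast (show 0 < M by omega)
  set PM := μ.real {ω | M ≤ clusterCapIn Λ ω u} with hPM
  set r : ℝ := Real.exp (-(1 / (2 * (M : ℝ)))) with hr
  have hr0 : 0 < r := Real.exp_pos _
  have hr1 : r < 1 := Real.exp_lt_one_iff.2 (by rw [neg_lt_zero]; positivity)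
  -- termwise bound by (2.6)
  have hterm : ∀ n ∈ Finset.Ico (10 * M) Λ.card,
      μ.real {ω | n + 1 ≤ clusterCapIn Λ ω u} ≤ Real.exp (3 / 2) * PM * r ^ n := by
    intro n hn
    rw [Finset.mem_Ico] at hn
    have hnM : (10 : ℝ) ≤ (n : ℝ) / M := by
      rw [le_div_iff₀ hMpos]; exact_mod_cast hn.1
    have h1 : μ.real {ω | n + 1 ≤ clusterCapIn Λ ω u} ≤
        μ.real {ω | (n : ℝ) / M * typicalMax μ Λ ≤ (clusterCapIn Λ ω u : ℝ)} := by
      refine measureReal_mono (fun ω hω => ?_) (measure_ne_top _ _)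
      simp only [Set.mem_setOf_eq] at hω ⊢
      rw [← hM, div_mul_cancel₀ _ hMpos.ne']
      exact_mod_cast (Nat.le_succ n).trans hω
    have h2 := prodBernoulli_real_clusterCapIn_ge_le_exp_mul p hΛ u (le_trans (by norm_num) hnM)
    rw [← hμ, ← hM] at h2
    have hexp : Real.exp ((3 - (n : ℝ) / M) / 2) = Real.exp (3 / 2) * r ^ n := by
      rw [hr, ← Real.exp_nat_mul, ← Real.exp_add]
      congr 1
      field_simp
      ring
    refine h1.trans (h2.trans (le_of_eq ?_))
    rw [hexp]; ring
  -- geometric sums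
  have hgeomS : ∀ m : ℕ, ∑ k ∈ Finset.range m, r ^ k ≤ 1 / (1 - r) := by
    intro m
    rw [geom_sum_eq hr1.ne m]
    have h1r : 0 < 1 - r := by linarith
    rw [show (r ^ m - 1) / (r - 1) = (1 - r ^ m) / (1 - r) by
      rw [← neg_sub 1 (r ^ m), ← neg_sub 1 r, neg_div_neg_eq]]
    exact div_le_div_of_nonneg_right (by linarith [pow_nonneg hr0.le m]) h1r.le
  have hgeom : ∑ n ∈ Finset.Ico (10 * M) Λ.card, r ^ n ≤ r ^ (10 * M) / (1 - r) := by
    rw [Finset.sum_Ico_eq_sum_range]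
    simp_rw [pow_add]
    rw [← Finset.mul_sum, div_eq_mul_one_div]
    exact mul_le_mul_of_nonneg_left (hgeomS _) (pow_nonneg hr0.le _)
  -- `r^{10M} = e^{-5}` and `1/(1-r) ≤ 4M`
  have hr10 : r ^ (10 * M) = Real.exp (-5) := by
    rw [hr, ← Real.exp_nat_mul]
    congr 1
    push_cast
    field_simp
    ring
  have h1r : 1 / (1 - r) ≤ 4 * M := by
    have hx0 : (0 : ℝ) ≤ 1 / (2 * M) := by positivity
    have hx1 : 1 / (2 * (M : ℝ)) ≤ 1 := by
      rw [div_le_one (by positivity)]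
      have : (2 : ℝ) ≤ M := by exact_mod_cast hM2
      linarith
    -- `1 - e^{-x} ≥ x/2` for `x = 1/(2M) ∈ [0,1]` (`e^{-x} ≤ 1/(1+x) ≤ 1 - x/2`)
    have h : 1 / (2 * (M : ℝ)) / 2 ≤ 1 - Real.exp (-(1 / (2 * (M : ℝ)))) := by
      have hx : Real.exp (-(1 / (2 * (M : ℝ)))) ≤ 1 / (1 + 1 / (2 * (M : ℝ))) := by
        rw [Real.exp_neg, one_div (1 + _)]
        exact inv_anti₀ (by linarith) (by linarith [Real.add_one_le_exp (1 / (2 * (M : ℝ)))])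
      have h2 : 1 / (1 + 1 / (2 * (M : ℝ))) ≤ 1 - 1 / (2 * (M : ℝ)) / 2 := by
        rw [div_le_iff₀ (by linarith)]
        nlinarith
      linarith
    rw [← hr] at h
    have hpos : 0 < 1 - r := by linarith
    have h' : 1 / (4 * (M : ℝ)) ≤ 1 - r := by
      calc 1 / (4 * (M : ℝ)) = 1 / (2 * M) / 2 := by ring
        _ ≤ 1 - r := h
    rw [div_le_iff₀ (by positivity)] at h'
    rw [div_le_iff₀ hpos]
    linarith
  -- assemble
  calc ∑ n ∈ Finset.Ico (10 * M) Λ.card, μ.real {ω | n + 1 ≤ clusterCapIn Λ ω u}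
      ≤ ∑ n ∈ Finset.Ico (10 * M) Λ.card, Real.exp (3 / 2) * PM * r ^ n := Finset.sum_le_sum hterm
    _ = Real.exp (3 / 2) * PM * ∑ n ∈ Finset.Ico (10 * M) Λ.card, r ^ n := by rw [Finset.mul_sum]
    _ ≤ Real.exp (3 / 2) * PM * (r ^ (10 * M) / (1 - r)) :=
        mul_le_mul_of_nonneg_left hgeom (mul_nonneg (Real.exp_nonneg _) measureReal_nonneg)
    _ = Real.exp (3 / 2) * Real.exp (-5) * (1 / (1 - r)) * PM := by rw [hr10]; ring
    _ ≤ Real.exp (3 / 2) * Real.exp (-5) * (4 * M) * PM := by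
        apply mul_le_mul_of_nonneg_right _ measureReal_nonneg
        exact mul_le_mul_of_nonneg_left h1r (by positivity)
    _ = 4 * Real.exp (-(7 / 2 : ℝ)) * ((M : ℝ) * PM) := by
        rw [show Real.exp (3 / 2) * Real.exp (-5) = Real.exp (-(7 / 2 : ℝ)) by
          rw [← Real.exp_add]; norm_num]
        ring
    _ ≤ (1 / 4) * ((M : ℝ) * PM) :=
        mul_le_mul_of_nonneg_right four_mul_exp_neg_le (mul_nonneg hMpos.le measureReal_nonneg)
    _ ≤ (1 / 4) * ∑ n ∈ Finset.range Λ.card, μ.real {ω | n + 1 ≤ clusterCapIn Λ ω u} :=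
        mul_le_mul_of_nonneg_left (typicalMax_mul_real_le_sum p u) (by norm_num)

/-- **The head up to `10 M` carries three quarters of `E|K_u ∩ Λ|`** ("`E[|K| ∧ N] ≥ ½ E|K|` if
`N ≥ 99M`", (2.12), with our constants). [cite: Hutchcroft2022, proof of Lemma 2.9 (2.12)] -/
theorem sum_real_clusterCapIn_ge_head_ge (hΛ : Λ.Nonempty) (u : V) :
    (3 / 4) * ∑ n ∈ Finset.range Λ.card, (prodBernoulli p).real {ω | n + 1 ≤ clusterCapIn Λ ω u} ≤
      ∑ n ∈ Finset.range (min (10 * typicalMax (prodBernoulli p) Λ) Λ.card),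
        (prodBernoulli p).real {ω | n + 1 ≤ clusterCapIn Λ ω u} := by
  set μ := prodBernoulli p with hμ
  set M := typicalMax μ Λ with hM
  set f : ℕ → ℝ := fun n => μ.real {ω | n + 1 ≤ clusterCapIn Λ ω u} with hf
  have hsplit := Finset.sum_range_add_sum_Ico f (min_le_right (10 * M) Λ.card)
  have htail : ∑ n ∈ Finset.Ico (min (10 * M) Λ.card) Λ.card, f n ≤
      (1 / 4) * ∑ n ∈ Finset.range Λ.card, f n := by
    rcases le_total (10 * M) Λ.card with h | h
    · rw [min_eq_left h]; exact sum_real_clusterCapIn_ge_tail_le p hΛ u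
    · rw [min_eq_right h, Finset.Ico_self, Finset.sum_empty]
      exact mul_nonneg (by norm_num) (Finset.sum_nonneg fun _ _ => measureReal_nonneg)
  simp only [hf] at hsplit htail ⊢
  linarith

omit [DecidableEq V] [Countable V] in
/-- Elementary: `min(1, τ/τ') · (k ∧ τ') ≤ k ∧ τ` for `k ≥ 0`, `τ, τ' > 0`. [folklore] -/
theorem min_one_div_mul_min_le {k τ τ' : ℝ} (hk : 0 ≤ k) (hτ : 0 < τ) (hτ' : 0 < τ') :
    min 1 (τ / τ') * min k τ' ≤ min k τ := by
  rcases le_total τ' τ with h | h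
  · -- factor `1`
    have h1 : (1 : ℝ) ≤ τ / τ' := by rw [le_div_iff₀ hτ']; linarith
    rw [min_eq_left h1, one_mul]
    exact min_le_min_left k h
  · have h1 : τ / τ' ≤ 1 := by rw [div_le_one hτ']; exact h
    rw [min_eq_right h1]
    have hq0 : 0 ≤ τ / τ' := div_nonneg hτ.le hτ'.le
    rcases le_total k τ' with hk' | hk'
    · rw [min_eq_left hk']
      rcases le_total k τ with hkτ | hkτ
      · rw [min_eq_left hkτ]
        calc τ / τ' * k ≤ 1 * k := mul_le_mul_of_nonneg_right h1 hk
          _ = k := one_mul k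
      · rw [min_eq_right hkτ]
        calc τ / τ' * k ≤ τ / τ' * τ' := mul_le_mul_of_nonneg_left hk' hq0
          _ = τ := div_mul_cancel₀ τ hτ'.ne'
    · rw [min_eq_right hk', div_mul_cancel₀ τ hτ'.ne']
      exact le_min (le_trans h hk') le_rfl

/-- **Lemma 2.9 (Truncating at the typical maximum)**, explicit form: for every `τ > 0`,
`E[|K_u ∩ Λ| ∧ τ] ≥ ½ min(1, τ/(10 M(Λ))) E|K_u ∩ Λ|` (the printed `E[|K| ∧ λM] ≥ aλ E|K|` for
`0 < λ ≤ 1` is the case `τ = λM`, `a = 1/20`; here for `|K_u ∩ Λ|` under any product Bernoulli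
measure, e.g. `K_B(x) ∩ B` under the law of `η_B`). [cite: Hutchcroft2022, Lemma 2.9] -/
theorem integral_min_clusterCapIn_ge (hΛ : Λ.Nonempty) (u : V) {τ : ℝ} (hτ : 0 < τ) :
    (1 / 2) * min 1 (τ / (10 * (typicalMax (prodBernoulli p) Λ : ℝ))) *
        ∫ ω, (clusterCapIn Λ ω u : ℝ) ∂(prodBernoulli p) ≤
      ∫ ω, min (clusterCapIn Λ ω u : ℝ) τ ∂(prodBernoulli p) := by
  set μ := prodBernoulli p with hμ
  set M := typicalMax μ Λ with hM
  have hM2 : 2 ≤ M := two_le_typicalMax μ hΛ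
  set τ' : ℝ := 10 * (M : ℝ) with hτ'
  have hτ'0 : 0 < τ' := by
    have : (2 : ℝ) ≤ M := by exact_mod_cast hM2
    rw [hτ']; linarith
  -- Step A: `∫ (|C| ∧ 10M) ≥ ¾ ∫ |C|`
  have hA : (3 / 4) * ∫ ω, (clusterCapIn Λ ω u : ℝ) ∂μ ≤ ∫ ω, min (clusterCapIn Λ ω u : ℝ) τ' ∂μ := by
    rw [integral_clusterCapIn_eq_sum_real_ge, integral_min_clusterCapIn_eq_sum μ Λ u hτ'0.le]
    calc (3 / 4) * ∑ n ∈ Finset.range Λ.card, μ.real {ω | n + 1 ≤ clusterCapIn Λ ω u}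
        ≤ ∑ n ∈ Finset.range (min (10 * M) Λ.card), μ.real {ω | n + 1 ≤ clusterCapIn Λ ω u} :=
          sum_real_clusterCapIn_ge_head_ge p hΛ u
      _ = ∑ n ∈ Finset.range (min (10 * M) Λ.card),
            (min ((n : ℝ) + 1) τ' - min (n : ℝ) τ') * μ.real {ω | n + 1 ≤ clusterCapIn Λ ω u} := by
          refine Finset.sum_congr rfl fun n hn => ?_
          have hn' : n + 1 ≤ 10 * M := by
            have := Finset.mem_range.1 hn; omega
          have hn'' : (n : ℝ) + 1 ≤ τ' := by rw [hτ']; exact_mod_cast hn'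
          rw [min_eq_left hn'', min_eq_left (by linarith), add_sub_cancel_left, one_mul]
      _ ≤ ∑ n ∈ Finset.range Λ.card,
            (min ((n : ℝ) + 1) τ' - min (n : ℝ) τ') * μ.real {ω | n + 1 ≤ clusterCapIn Λ ω u} :=
          Finset.sum_le_sum_of_subset_of_nonneg (Finset.range_subset_range.2 (min_le_right _ _))
            fun n _ _ => mul_nonneg (min_succ_sub_min_nonneg n τ') measureReal_nonneg
  -- Step B: pointwise scaling
  have hB : min 1 (τ / τ') * ∫ ω, min (clusterCapIn Λ ω u : ℝ) τ' ∂μ ≤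
      ∫ ω, min (clusterCapIn Λ ω u : ℝ) τ ∂μ := by
    rw [← integral_const_mul]
    exact integral_mono ((integrable_min_clusterCapIn μ Λ u hτ'0.le).const_mul _)
      (integrable_min_clusterCapIn μ Λ u hτ.le)
      fun ω => min_one_div_mul_min_le (Nat.cast_nonneg _) hτ hτ'0
  have hI0 : 0 ≤ ∫ ω, (clusterCapIn Λ ω u : ℝ) ∂μ := integral_nonneg fun ω => Nat.cast_nonneg _
  have hm0 : 0 ≤ min 1 (τ / τ') := le_min zero_le_one (div_nonneg hτ.le hτ'0.le)
  calc (1 / 2) * min 1 (τ / τ') * ∫ ω, (clusterCapIn Λ ω u : ℝ) ∂μ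
      ≤ min 1 (τ / τ') * ((3 / 4) * ∫ ω, (clusterCapIn Λ ω u : ℝ) ∂μ) := by nlinarith
    _ ≤ min 1 (τ / τ') * ∫ ω, min (clusterCapIn Λ ω u : ℝ) τ' ∂μ := mul_le_mul_of_nonneg_left hA hm0
    _ ≤ _ := hB

end Truncation

end Literature.Probability.Percolation

end
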